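import Mathlib
import HarnessLib
import Summits.HubbardSuperconductivity.HubbardSuperconductivity.Theorems.KLProgrammeH10TwoPointLimitPerturbedCountPeriodicDeriv

/-!
# Route `KLProgramme` — crux K1 `H10TwoPointLimit` (stmt-HubbardSuperconductivity-19938):
# sup bounds and Lipschitz constants of the perturbed level function along the counting fibres

Port step (3), second half (the lineage's `KLProgrammeCountPairsOffsetDeriv.lean` §DBounds on the moving curve). ONE master
Lipschitz estimate `abs_h3E_sub_le` for `∂₃h^E` in both angles, by direct differences — `sin` is `1`-Lipschitz, the perturbed curve
is `S_E`-Lipschitz (`abs_XE_sub_XE_le`), its velocity `A_E`-Lipschitz (`abs_VXE_sub_VXE_le`), `Dδ` is `κ₂`-Lipschitz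
(`abs_fderiv_apply_sub_le`) — whence the common Lipschitz constant `M_Γ = 8S_E² + 2κ₂S_E² + 4A_E + κ₁A_E` of the shift-line gate
`x ↦ ∂₂h^E(x, x+c)` (`abs_h3E_shift_sub_le`), of the `θ₃`-fibre derivative (`abs_h3E_three_sub_le`) and of the anti-diagonal sum of
partials `G` (`abs_G_sub_le`); and the sup bounds `|∂₃h^E| ≤ (4+κ₁)S_E` (`abs_h3E_le`), `|(d/dt)h^E(σ∓t/2)| ≤ (2A_E + κ₁A_E/2)|t|`
(`abs_anti_derivE_le`), `|(d/dx)h^E(x,x+c)| ≤ (4+κ₁)A_E|c - π|` for an even `δ` (`abs_shift_derivE_le`, central symmetry of the moving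
curve), `|(d²/dx²)h^E(x,x)| ≤ 16S_E² + 8A_E + 4κ₂S_E² + 2κ₁A_E` (`abs_diag_deriv2E_le`). Constants expanded as in
`…PerturbedCountCooper/Fold.lean` (`C_V, S_E, U₁, U₂, A_E`). Everything is PROVED; no definitions.
References: BGM 2006 Lemma 3.1 / App. A2 [cite: BenfattoGiulianiMastropietro2006]; HOME/prover-p4/COUNTING-NOTE.md.
-/

noncomputable section

namespace Summit.HubbardSuperconductivity.HubbardSuperconductivity.Theorems.PerturbedFermiCurve

set_option linter.dupNamespace false -- summit = problem name (single-conjunct summit), D-0017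

open Real Set
open Literature.MathematicalPhysics.QuantumLattice Literature.MathematicalPhysics.QuantumLattice.BandSectorCounting

section Fibres

variable {a b : ℝ} (B : BandBounds a b) {δ : (Fin 2 → ℝ) → ℝ} (hδs : ContDiff ℝ 2 δ)
  {κ₀ κ₁ κ₂ μ : ℝ} (hδ : ∀ k : Fin 2 → ℝ, |δ k| ≤ κ₀) (hlo : a ≤ μ - κ₀) (hhi : μ + κ₀ ≤ b)
  (hκ : ∀ k : Fin 2 → ℝ, ‖fderiv ℝ δ k‖ ≤ κ₁) (hκ₁ : κ₁ < B.Dtmin) (hκ₂ : ∀ k : Fin 2 → ℝ, ‖fderiv ℝ (fderiv ℝ δ) k‖ ≤ κ₂)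
  {u : ℝ → ℝ} (hu : ∀ θ, IsBandFermiRadius (μ - δ (u θ • dir θ)) θ (u θ))
include B hδs hδ hlo hhi hκ hκ₁ hu

/-! ## §1 Lipschitz bounds by direct differences -/

/-- **The perturbed curve is `S_E`-Lipschitz**: `|X_E(x) - X_E(y)|, |Y_E(x) - Y_E(y)| ≤ S_E |x - y|`. [folklore] -/
theorem abs_XE_sub_XE_le (x y : ℝ) :
    |XE u x - XE u y| ≤ (B.smax + κ₁ * (π * Real.sqrt 2 + 2 * B.smax) / (B.Dtmin - κ₁)) * |x - y| ∧
      |YE u x - YE u y| ≤ (B.smax + κ₁ * (π * Real.sqrt 2 + 2 * B.smax) / (B.Dtmin - κ₁)) * |x - y| := by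
  have h2ne : (2 : WithTop ℕ∞) ≠ 0 := by norm_num
  have hud : ∀ z, DifferentiableAt ℝ u z := fun z => (differentiableAt_root_and_deriv B hδs hδ hlo hhi hκ hκ₁ hu z).1
  have hb := fun z => abs_VXE_le B hδs h2ne (fun k _ => hδ k) hlo hhi (fun k _ => hκ k) hκ₁ hu z
  constructor
  · have h := convex_univ.norm_image_sub_le_of_norm_hasDerivWithin_le (f := XE u)
      (fun z _ => (hasDerivAt_XE (hud z)).hasDerivWithinAt)
      (fun z _ => by rw [Real.norm_eq_abs]; exact (hb z).1) (mem_univ y) (mem_univ x)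
    rw [Real.norm_eq_abs, Real.norm_eq_abs] at h; exact h
  · have h := convex_univ.norm_image_sub_le_of_norm_hasDerivWithin_le (f := YE u)
      (fun z _ => (hasDerivAt_YE (hud z)).hasDerivWithinAt)
      (fun z _ => by rw [Real.norm_eq_abs]; exact (hb z).2) (mem_univ y) (mem_univ x)
    rw [Real.norm_eq_abs, Real.norm_eq_abs] at h; exact h

/-- The momentum sum moves by at most `S_E(|Δθ₂| + |Δθ₃|)` in each coordinate and in sup norm. [folklore] -/
theorem abs_SXE_sub_le (P : ℝ × ℝ) (θ₂ θ₃ θ₂' θ₃' : ℝ) :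
    |SXE u P θ₂ θ₃ - SXE u P θ₂' θ₃'| ≤ (B.smax + κ₁ * (π * Real.sqrt 2 + 2 * B.smax) / (B.Dtmin - κ₁)) * (|θ₂ - θ₂'| + |θ₃ - θ₃'|) ∧
      |SYE u P θ₂ θ₃ - SYE u P θ₂' θ₃'| ≤ (B.smax + κ₁ * (π * Real.sqrt 2 + 2 * B.smax) / (B.Dtmin - κ₁)) * (|θ₂ - θ₂'| + |θ₃ - θ₃'|) ∧
      ‖momE u P θ₂ θ₃ - momE u P θ₂' θ₃'‖ ≤ (B.smax + κ₁ * (π * Real.sqrt 2 + 2 * B.smax) / (B.Dtmin - κ₁)) * (|θ₂ - θ₂'| + |θ₃ - θ₃'|) := by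
  obtain ⟨hx2, hy2⟩ := abs_XE_sub_XE_le B hδs hδ hlo hhi hκ hκ₁ hu θ₂ θ₂'
  obtain ⟨hx3, hy3⟩ := abs_XE_sub_XE_le B hδs hδ hlo hhi hκ hκ₁ hu θ₃ θ₃'
  have ex : |SXE u P θ₂ θ₃ - SXE u P θ₂' θ₃'| ≤ (B.smax + κ₁ * (π * Real.sqrt 2 + 2 * B.smax) / (B.Dtmin - κ₁)) * (|θ₂ - θ₂'| + |θ₃ - θ₃'|) := by
    have e : SXE u P θ₂ θ₃ - SXE u P θ₂' θ₃' = (XE u θ₂ - XE u θ₂') + (XE u θ₃ - XE u θ₃') := by unfold SXE; ring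
    rw [e, mul_add]; exact (abs_add_le _ _).trans (add_le_add hx2 hx3)
  have ey : |SYE u P θ₂ θ₃ - SYE u P θ₂' θ₃'| ≤ (B.smax + κ₁ * (π * Real.sqrt 2 + 2 * B.smax) / (B.Dtmin - κ₁)) * (|θ₂ - θ₂'| + |θ₃ - θ₃'|) := by
    have e : SYE u P θ₂ θ₃ - SYE u P θ₂' θ₃' = (YE u θ₂ - YE u θ₂') + (YE u θ₃ - YE u θ₃') := by unfold SYE; ring
    rw [e, mul_add]; exact (abs_add_le _ _).trans (add_le_add hy2 hy3)
  refine ⟨ex, ey, ?_⟩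
  unfold momE
  exact norm_vec2_sub_le ((abs_nonneg _).trans ex) ex ey

include hκ₂

/-- **Master Lipschitz estimate for `∂₃h^E` in both angles**:
`|∂₃h^E(θ₂,θ₃) - ∂₃h^E(θ₂',θ₃')| ≤ (4S_E² + κ₂S_E²)(|Δθ₂| + |Δθ₃|) + (4A_E + κ₁A_E)|Δθ₃|`. [folklore] -/
theorem abs_h3E_sub_le (P : ℝ × ℝ) (θ₂ θ₃ θ₂' θ₃' : ℝ) :
    |h3E δ u P θ₂ θ₃ - h3E δ u P θ₂' θ₃'| ≤
      (4 * (B.smax + κ₁ * (π * Real.sqrt 2 + 2 * B.smax) / (B.Dtmin - κ₁)) ^ 2 + κ₂ * (B.smax + κ₁ * (π * Real.sqrt 2 + 2 * B.smax) / (B.Dtmin - κ₁)) ^ 2) * (|θ₂ - θ₂'| + |θ₃ - θ₃'|) +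
        (4 * ((((4 + κ₂) * (B.smax + κ₁ * (π * Real.sqrt 2 + 2 * B.smax) / (B.Dtmin - κ₁)) ^ 2 + (8 + 2 * κ₁) * ((4 + κ₁) * (π * Real.sqrt 2) / (B.Dtmin - κ₁)) + (4 + κ₁) * (π * Real.sqrt 2)) / (B.Dtmin - κ₁)) + 2 * ((4 + κ₁) * (π * Real.sqrt 2) / (B.Dtmin - κ₁)) + π * Real.sqrt 2) + κ₁ * ((((4 + κ₂) * (B.smax + κ₁ * (π * Real.sqrt 2 + 2 * B.smax) / (B.Dtmin - κ₁)) ^ 2 + (8 + 2 * κ₁) * ((4 + κ₁) * (π * Real.sqrt 2) / (B.Dtmin - κ₁)) + (4 + κ₁) * (π * Real.sqrt 2)) / (B.Dtmin - κ₁)) + 2 * ((4 + κ₁) * (π * Real.sqrt 2) / (B.Dtmin - κ₁)) + π * Real.sqrt 2)) * |θ₃ - θ₃'| := by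
  have h2ne : (2 : WithTop ℕ∞) ≠ 0 := by norm_num
  obtain ⟨hsx, hsy, hmom⟩ := abs_SXE_sub_le B hδs hδ hlo hhi hκ hκ₁ hu P θ₂ θ₃ θ₂' θ₃'
  obtain ⟨hvx, hvy⟩ := abs_VXE_sub_VXE_le B hδs hδ hlo hhi hκ hκ₁ hκ₂ hu θ₃ θ₃'
  obtain ⟨bvx, bvy⟩ := abs_VXE_le B hδs h2ne (fun k _ => hδ k) hlo hhi (fun k _ => hκ k) hκ₁ hu θ₃
  obtain ⟨bvx', bvy'⟩ := abs_VXE_le B hδs h2ne (fun k _ => hδ k) hlo hhi (fun k _ => hκ k) hκ₁ hu θ₃'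
  set SE := (B.smax + κ₁ * (π * Real.sqrt 2 + 2 * B.smax) / (B.Dtmin - κ₁)) with hSE
  set AE := ((((4 + κ₂) * (B.smax + κ₁ * (π * Real.sqrt 2 + 2 * B.smax) / (B.Dtmin - κ₁)) ^ 2 + (8 + 2 * κ₁) * ((4 + κ₁) * (π * Real.sqrt 2) / (B.Dtmin - κ₁)) + (4 + κ₁) * (π * Real.sqrt 2)) / (B.Dtmin - κ₁)) + 2 * ((4 + κ₁) * (π * Real.sqrt 2) / (B.Dtmin - κ₁)) + π * Real.sqrt 2) with hAE
  clear_value SE AE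
  set d := |θ₂ - θ₂'| + |θ₃ - θ₃'| with hd
  have hd3 : |θ₃ - θ₃'| ≤ d := by rw [hd]; linarith [abs_nonneg (θ₂ - θ₂')]
  have hSE0 : 0 ≤ SE := (abs_nonneg _).trans bvx
  have hκ₁0 : 0 ≤ κ₁ := (norm_nonneg _).trans (hκ 0)
  have hκ₂0 : 0 ≤ κ₂ := (norm_nonneg (fderiv ℝ (fderiv ℝ δ) 0)).trans (hκ₂ 0)
  have hd0 : 0 ≤ d := by positivity
  have hAE0 : 0 ≤ AE * |θ₃ - θ₃'| := (abs_nonneg _).trans hvx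
  -- the two trigonometric terms
  have tx := abs_two_sin_mul_sub_le hsx hvx bvx
  have ty := abs_two_sin_mul_sub_le hsy hvy bvy
  -- the `Dδ` term
  have hvdiff : ‖(![VXE u θ₃, VYE u θ₃] : Fin 2 → ℝ) - ![VXE u θ₃', VYE u θ₃']‖ ≤ AE * |θ₃ - θ₃'| :=
    norm_vec2_sub_le hAE0 hvx hvy
  have hv' : ‖(![VXE u θ₃', VYE u θ₃'] : Fin 2 → ℝ)‖ ≤ SE := norm_vec2_le hSE0 bvx' bvy'
  have tD := abs_fderiv_apply_sub_le hδs hκ hκ₂ (momE u P θ₂ θ₃) (momE u P θ₂' θ₃') ![VXE u θ₃, VYE u θ₃] ![VXE u θ₃', VYE u θ₃']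
  have tD1 : κ₁ * ‖(![VXE u θ₃, VYE u θ₃] : Fin 2 → ℝ) - ![VXE u θ₃', VYE u θ₃']‖ ≤ κ₁ * (AE * |θ₃ - θ₃'|) :=
    mul_le_mul_of_nonneg_left hvdiff hκ₁0
  have tD2 : κ₂ * ‖momE u P θ₂ θ₃ - momE u P θ₂' θ₃'‖ * ‖(![VXE u θ₃', VYE u θ₃'] : Fin 2 → ℝ)‖ ≤ κ₂ * (SE * d) * SE :=
    mul_le_mul (mul_le_mul_of_nonneg_left hmom hκ₂0) hv' (norm_nonneg _) (by positivity)
  -- assemble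
  have hid : h3E δ u P θ₂ θ₃ - h3E δ u P θ₂' θ₃' =
      (2 * Real.sin (SXE u P θ₂ θ₃) * VXE u θ₃ - 2 * Real.sin (SXE u P θ₂' θ₃') * VXE u θ₃') +
      (2 * Real.sin (SYE u P θ₂ θ₃) * VYE u θ₃ - 2 * Real.sin (SYE u P θ₂' θ₃') * VYE u θ₃') +
      (fderiv ℝ δ (momE u P θ₂ θ₃) ![VXE u θ₃, VYE u θ₃] - fderiv ℝ δ (momE u P θ₂' θ₃') ![VXE u θ₃', VYE u θ₃']) := by
    unfold h3E; ring
  rw [hid]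
  have h1 := abs_add_le ((2 * Real.sin (SXE u P θ₂ θ₃) * VXE u θ₃ - 2 * Real.sin (SXE u P θ₂' θ₃') * VXE u θ₃') +
      (2 * Real.sin (SYE u P θ₂ θ₃) * VYE u θ₃ - 2 * Real.sin (SYE u P θ₂' θ₃') * VYE u θ₃'))
    (fderiv ℝ δ (momE u P θ₂ θ₃) ![VXE u θ₃, VYE u θ₃] - fderiv ℝ δ (momE u P θ₂' θ₃') ![VXE u θ₃', VYE u θ₃'])
  have h2 := abs_add_le (2 * Real.sin (SXE u P θ₂ θ₃) * VXE u θ₃ - 2 * Real.sin (SXE u P θ₂' θ₃') * VXE u θ₃')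
      (2 * Real.sin (SYE u P θ₂ θ₃) * VYE u θ₃ - 2 * Real.sin (SYE u P θ₂' θ₃') * VYE u θ₃')
  linarith only [h1, h2, tx, ty, tD, tD1, tD2]

/-! ## §2 Sup bounds and Lipschitz constants along the fibres -/

omit hκ₂ in
/-- `|∂₃h^E| ≤ (4 + κ₁) S_E`. [folklore] -/
theorem abs_h3E_le (P : ℝ × ℝ) (θ₂ θ₃ : ℝ) :
    |h3E δ u P θ₂ θ₃| ≤ (4 + κ₁) * (B.smax + κ₁ * (π * Real.sqrt 2 + 2 * B.smax) / (B.Dtmin - κ₁)) := by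
  have h2ne : (2 : WithTop ℕ∞) ≠ 0 := by norm_num
  obtain ⟨bvx, bvy⟩ := abs_VXE_le B hδs h2ne (fun k _ => hδ k) hlo hhi (fun k _ => hκ k) hκ₁ hu θ₃
  have hSE0 := (abs_nonneg _).trans bvx
  have hD := abs_fderiv_vec2_le (hκ (momE u P θ₂ θ₃)) hSE0 bvx bvy
  unfold h3E
  have h1 := abs_add_le (2 * Real.sin (SXE u P θ₂ θ₃) * VXE u θ₃ + 2 * Real.sin (SYE u P θ₂ θ₃) * VYE u θ₃)
    (fderiv ℝ δ (momE u P θ₂ θ₃) ![VXE u θ₃, VYE u θ₃])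
  have h2 := abs_add_le (2 * Real.sin (SXE u P θ₂ θ₃) * VXE u θ₃) (2 * Real.sin (SYE u P θ₂ θ₃) * VYE u θ₃)
  have e1 : |2 * Real.sin (SXE u P θ₂ θ₃) * VXE u θ₃| ≤ 2 * (B.smax + κ₁ * (π * Real.sqrt 2 + 2 * B.smax) / (B.Dtmin - κ₁)) := by
    rw [abs_mul, abs_mul, abs_two]
    have := mul_le_mul (Real.abs_sin_le_one (SXE u P θ₂ θ₃)) bvx (abs_nonneg _) zero_le_one
    linarith
  have e2 : |2 * Real.sin (SYE u P θ₂ θ₃) * VYE u θ₃| ≤ 2 * (B.smax + κ₁ * (π * Real.sqrt 2 + 2 * B.smax) / (B.Dtmin - κ₁)) := by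
    rw [abs_mul, abs_mul, abs_two]
    have := mul_le_mul (Real.abs_sin_le_one (SYE u P θ₂ θ₃)) bvy (abs_nonneg _) zero_le_one
    linarith
  linarith

/-- **Lipschitz constant of the shift-line gate** `x ↦ ∂₂h^E(x, x+c) = h3E(x+c, x)`: `M_Γ = 8S_E² + 2κ₂S_E² + 4A_E + κ₁A_E`. [folklore] -/
theorem abs_h3E_shift_sub_le (P : ℝ × ℝ) (c z z' : ℝ) :
    |h3E δ u P (z + c) z - h3E δ u P (z' + c) z'| ≤ (8 * (B.smax + κ₁ * (π * Real.sqrt 2 + 2 * B.smax) / (B.Dtmin - κ₁)) ^ 2 + 2 * (κ₂ * (B.smax + κ₁ * (π * Real.sqrt 2 + 2 * B.smax) / (B.Dtmin - κ₁)) ^ 2) + 4 * ((((4 + κ₂) * (B.smax + κ₁ * (π * Real.sqrt 2 + 2 * B.smax) / (B.Dtmin - κ₁)) ^ 2 + (8 + 2 * κ₁) * ((4 + κ₁) * (π * Real.sqrt 2) / (B.Dtmin - κ₁)) + (4 + κ₁) * (π * Real.sqrt 2)) / (B.Dtmin - κ₁)) + 2 * ((4 + κ₁) * (π * Real.sqrt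 2) / (B.Dtmin - κ₁)) + π * Real.sqrt 2) + κ₁ * ((((4 + κ₂) * (B.smax + κ₁ * (π * Real.sqrt 2 + 2 * B.smax) / (B.Dtmin - κ₁)) ^ 2 + (8 + 2 * κ₁) * ((4 + κ₁) * (π * Real.sqrt 2) / (B.Dtmin - κ₁)) + (4 + κ₁) * (π * Real.sqrt 2)) / (B.Dtmin - κ₁)) + 2 * ((4 + κ₁) * (π * Real.sqrt 2) / (B.Dtmin - κ₁)) + π * Real.sqrt 2)) * |z - z'| := by
  have h := abs_h3E_sub_le B hδs hδ hlo hhi hκ hκ₁ hκ₂ hu P (z + c) z (z' + c) z'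
  rw [show z + c - (z' + c) = z - z' by ring] at h
  refine h.trans (le_of_eq ?_); ring

/-- **Lipschitz constant of `∂₃h^E` in `θ₃`** (at most `M_Γ`). [folklore] -/
theorem abs_h3E_three_sub_le (P : ℝ × ℝ) (θ₂ z z' : ℝ) :
    |h3E δ u P θ₂ z - h3E δ u P θ₂ z'| ≤ (8 * (B.smax + κ₁ * (π * Real.sqrt 2 + 2 * B.smax) / (B.Dtmin - κ₁)) ^ 2 + 2 * (κ₂ * (B.smax + κ₁ * (π * Real.sqrt 2 + 2 * B.smax) / (B.Dtmin - κ₁)) ^ 2) + 4 * ((((4 + κ₂) * (B.smax + κ₁ * (π * Real.sqrt 2 + 2 * B.smax) / (B.Dtmin - κ₁)) ^ 2 + (8 + 2 * κ₁) * ((4 + κ₁) * (π * Real.sqrt 2) / (B.Dtmin - κ₁)) + (4 + κ₁) * (π * Real.sqrt 2)) / (B.Dtmin - κ₁)) + 2 * ((4 + κ₁) * (π * Real.sqrt 2) / (B.Dtmin - κ₁)) + π * Real.sqrt 2) + κ₁ * ((((4 + κ₂) * (B.smax + κ₁ * (π * Real.sqrt 2 + 2 * B.smax) / (B.Dtmin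 - κ₁)) ^ 2 + (8 + 2 * κ₁) * ((4 + κ₁) * (π * Real.sqrt 2) / (B.Dtmin - κ₁)) + (4 + κ₁) * (π * Real.sqrt 2)) / (B.Dtmin - κ₁)) + 2 * ((4 + κ₁) * (π * Real.sqrt 2) / (B.Dtmin - κ₁)) + π * Real.sqrt 2)) * |z - z'| := by
  have h2ne : (2 : WithTop ℕ∞) ≠ 0 := by norm_num
  have h := abs_h3E_sub_le B hδs hδ hlo hhi hκ hκ₁ hκ₂ hu P θ₂ z θ₂ z'
  rw [sub_self, abs_zero, zero_add] at h
  obtain ⟨bvx, -⟩ := abs_VXE_le B hδs h2ne (fun k _ => hδ k) hlo hhi (fun k _ => hκ k) hκ₁ hu z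
  have hSE0 := (abs_nonneg _).trans bvx
  have hκ₂0 : 0 ≤ κ₂ := (norm_nonneg (fderiv ℝ (fderiv ℝ δ) 0)).trans (hκ₂ 0)
  refine h.trans ?_
  have hz := abs_nonneg (z - z')
  nlinarith [mul_nonneg (mul_nonneg hSE0 hSE0) hz, mul_nonneg (mul_nonneg hκ₂0 (mul_nonneg hSE0 hSE0)) hz]

/-- **Lipschitz constant of the anti-diagonal sum of partials** `G(t) = h3E(σ+t/2, σ-t/2) + h3E(σ-t/2, σ+t/2)`: `M_Γ`. [folklore] -/
theorem abs_G_sub_le (P : ℝ × ℝ) (σ t t' : ℝ) :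
    |(h3E δ u P (σ + t / 2) (σ - t / 2) + h3E δ u P (σ - t / 2) (σ + t / 2)) -
        (h3E δ u P (σ + t' / 2) (σ - t' / 2) + h3E δ u P (σ - t' / 2) (σ + t' / 2))| ≤ (8 * (B.smax + κ₁ * (π * Real.sqrt 2 + 2 * B.smax) / (B.Dtmin - κ₁)) ^ 2 + 2 * (κ₂ * (B.smax + κ₁ * (π * Real.sqrt 2 + 2 * B.smax) / (B.Dtmin - κ₁)) ^ 2) + 4 * ((((4 + κ₂) * (B.smax + κ₁ * (π * Real.sqrt 2 + 2 * B.smax) / (B.Dtmin - κ₁)) ^ 2 + (8 + 2 * κ₁) * ((4 + κ₁) * (π * Real.sqrt 2) / (B.Dtmin - κ₁)) + (4 + κ₁) * (π * Real.sqrt 2)) / (B.Dtmin - κ₁)) + 2 * ((4 + κ₁) * (π * Real.sqrt 2) / (B.Dtmin - κ₁)) + π * Real.sqrt 2) + κ₁ * ((((4 + κ₂) * (B.smax + κ₁ * (π * Real.sqrt 2 + 2 * B.smax) / (B.Dtmin - κ₁)) ^ 2 + (8 + 2 * κ₁) * ((4 + κ₁) * (π * Real.sqrt 2) / (B.Dtmin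 - κ₁)) + (4 + κ₁) * (π * Real.sqrt 2)) / (B.Dtmin - κ₁)) + 2 * ((4 + κ₁) * (π * Real.sqrt 2) / (B.Dtmin - κ₁)) + π * Real.sqrt 2)) * |t - t'| := by
  have h1 := abs_h3E_sub_le B hδs hδ hlo hhi hκ hκ₁ hκ₂ hu P (σ + t / 2) (σ - t / 2) (σ + t' / 2) (σ - t' / 2)
  have h2 := abs_h3E_sub_le B hδs hδ hlo hhi hκ hκ₁ hκ₂ hu P (σ - t / 2) (σ + t / 2) (σ - t' / 2) (σ + t' / 2)
  have ep : |σ + t / 2 - (σ + t' / 2)| = |t - t'| / 2 := by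
    rw [show σ + t / 2 - (σ + t' / 2) = (t - t') / 2 by ring, abs_div, abs_two]
  have em : |σ - t / 2 - (σ - t' / 2)| = |t - t'| / 2 := by
    rw [show σ - t / 2 - (σ - t' / 2) = -((t - t') / 2) by ring, abs_neg, abs_div, abs_two]
  rw [ep, em] at h1 h2
  have h3 := abs_sub (h3E δ u P (σ + t / 2) (σ - t / 2) + h3E δ u P (σ - t / 2) (σ + t / 2) -
      (h3E δ u P (σ + t' / 2) (σ - t' / 2) + h3E δ u P (σ - t' / 2) (σ + t' / 2))) 0
  have e : h3E δ u P (σ + t / 2) (σ - t / 2) + h3E δ u P (σ - t / 2) (σ + t / 2) -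
      (h3E δ u P (σ + t' / 2) (σ - t' / 2) + h3E δ u P (σ - t' / 2) (σ + t' / 2)) =
      (h3E δ u P (σ + t / 2) (σ - t / 2) - h3E δ u P (σ + t' / 2) (σ - t' / 2)) +
        (h3E δ u P (σ - t / 2) (σ + t / 2) - h3E δ u P (σ - t' / 2) (σ + t' / 2)) := by ring
  rw [e]
  refine (abs_add_le _ _).trans ?_
  have := add_le_add h1 h2
  refine this.trans (le_of_eq ?_); ring

/-- **Sup bound of the anti-diagonal derivative**: `≤ (2A_E + κ₁A_E/2)|t|`. [folklore] -/
theorem abs_anti_derivE_le (P : ℝ × ℝ) (σ t : ℝ) :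
    |Real.sin (SXE u P (σ - t / 2) (σ + t / 2)) * (VXE u (σ + t / 2) - VXE u (σ - t / 2)) +
        Real.sin (SYE u P (σ - t / 2) (σ + t / 2)) * (VYE u (σ + t / 2) - VYE u (σ - t / 2)) +
        fderiv ℝ δ (momE u P (σ - t / 2) (σ + t / 2))
          ![(VXE u (σ + t / 2) - VXE u (σ - t / 2)) / 2, (VYE u (σ + t / 2) - VYE u (σ - t / 2)) / 2]| ≤
      (2 * ((((4 + κ₂) * (B.smax + κ₁ * (π * Real.sqrt 2 + 2 * B.smax) / (B.Dtmin - κ₁)) ^ 2 + (8 + 2 * κ₁) * ((4 + κ₁) * (π * Real.sqrt 2) / (B.Dtmin - κ₁)) + (4 + κ₁) * (π * Real.sqrt 2)) / (B.Dtmin - κ₁)) + 2 * ((4 + κ₁) * (π * Real.sqrt 2) / (B.Dtmin - κ₁)) + π * Real.sqrt 2) + κ₁ * ((((4 + κ₂) * (B.smax + κ₁ * (π * Real.sqrt 2 + 2 * B.smax) / (B.Dtmin - κ₁)) ^ 2 + (8 + 2 * κ₁) * ((4 + κ₁) * (π * Real.sqrt 2) / (B.Dtmin - κ₁)) + (4 +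 κ₁) * (π * Real.sqrt 2)) / (B.Dtmin - κ₁)) + 2 * ((4 + κ₁) * (π * Real.sqrt 2) / (B.Dtmin - κ₁)) + π * Real.sqrt 2) / 2) * |t| := by
  obtain ⟨hvx, hvy⟩ := abs_VXE_sub_VXE_le B hδs hδ hlo hhi hκ hκ₁ hκ₂ hu (σ + t / 2) (σ - t / 2)
  rw [show σ + t / 2 - (σ - t / 2) = t by ring] at hvx hvy
  set AE := ((((4 + κ₂) * (B.smax + κ₁ * (π * Real.sqrt 2 + 2 * B.smax) / (B.Dtmin - κ₁)) ^ 2 + (8 + 2 * κ₁) * ((4 + κ₁) * (π * Real.sqrt 2) / (B.Dtmin - κ₁)) + (4 + κ₁) * (π * Real.sqrt 2)) / (B.Dtmin - κ₁)) + 2 * ((4 + κ₁) * (π * Real.sqrt 2) / (B.Dtmin - κ₁)) + π * Real.sqrt 2) with hAE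
  clear_value AE
  have hAt : 0 ≤ AE * |t| := (abs_nonneg _).trans hvx
  have hD : |fderiv ℝ δ (momE u P (σ - t / 2) (σ + t / 2))
      ![(VXE u (σ + t / 2) - VXE u (σ - t / 2)) / 2, (VYE u (σ + t / 2) - VYE u (σ - t / 2)) / 2]| ≤ κ₁ * (AE * |t| / 2) := by
    refine abs_fderiv_vec2_le (hκ _) (by positivity) ?_ ?_
    · rw [abs_div, abs_two]; linarith
    · rw [abs_div, abs_two]; linarith
  have h12 := abs_two_term_le (Real.abs_sin_le_one (SXE u P (σ - t / 2) (σ + t / 2))) hvx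
    (Real.abs_sin_le_one (SYE u P (σ - t / 2) (σ + t / 2))) hvy
  have h := abs_add_le (Real.sin (SXE u P (σ - t / 2) (σ + t / 2)) * (VXE u (σ + t / 2) - VXE u (σ - t / 2)) +
        Real.sin (SYE u P (σ - t / 2) (σ + t / 2)) * (VYE u (σ + t / 2) - VYE u (σ - t / 2)))
    (fderiv ℝ δ (momE u P (σ - t / 2) (σ + t / 2))
          ![(VXE u (σ + t / 2) - VXE u (σ - t / 2)) / 2, (VYE u (σ + t / 2) - VYE u (σ - t / 2)) / 2])
  linarith

/-- **Sup bound of the shift-line derivative for an EVEN perturbation**: `|∂₂h^E + ∂₃h^E| ≤ (4 + κ₁)A_E|c - π|` along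
`θ₃ = θ₂ + c` (central symmetry `p_E'(θ + π) = -p_E'(θ)`). [folklore] -/
theorem abs_shift_derivE_le (heven : ∀ k, δ (-k) = δ k) (P : ℝ × ℝ) (c x : ℝ) :
    |h3E δ u P (x + c) x + h3E δ u P x (x + c)| ≤ (4 + κ₁) * ((((4 + κ₂) * (B.smax + κ₁ * (π * Real.sqrt 2 + 2 * B.smax) / (B.Dtmin - κ₁)) ^ 2 + (8 + 2 * κ₁) * ((4 + κ₁) * (π * Real.sqrt 2) / (B.Dtmin - κ₁)) + (4 + κ₁) * (π * Real.sqrt 2)) / (B.Dtmin - κ₁)) + 2 * ((4 + κ₁) * (π * Real.sqrt 2) / (B.Dtmin - κ₁)) + π * Real.sqrt 2) * |c - π| := by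
  have h2ne : (2 : WithTop ℕ∞) ≠ 0 := by norm_num
  have hδ' : ∀ k : Fin 2 → ℝ, (∀ i, |k i| ≤ π) → |δ k| ≤ κ₀ := fun k _ => hδ k
  have hκ' : ∀ k : Fin 2 → ℝ, (∀ i, |k i| ≤ π) → ‖fderiv ℝ δ k‖ ≤ κ₁ := fun k _ => hκ k
  have hd' : ∀ k : Fin 2 → ℝ, (∀ i, |k i| ≤ π) → DifferentiableAt ℝ δ k := fun k _ => (hδs.differentiable h2ne) k
  obtain ⟨-, -, qvx, qvy⟩ := curve_add_pi B hδ' hlo hhi hd' hκ' hκ₁ hu heven (x + (c - π))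
  rw [show x + (c - π) + π = x + c by ring] at qvx qvy
  obtain ⟨hvx, hvy⟩ := abs_VXE_sub_VXE_le B hδs hδ hlo hhi hκ hκ₁ hκ₂ hu x (x + (c - π))
  rw [show x - (x + (c - π)) = -(c - π) by ring, abs_neg] at hvx hvy
  set AE := ((((4 + κ₂) * (B.smax + κ₁ * (π * Real.sqrt 2 + 2 * B.smax) / (B.Dtmin - κ₁)) ^ 2 + (8 + 2 * κ₁) * ((4 + κ₁) * (π * Real.sqrt 2) / (B.Dtmin - κ₁)) + (4 + κ₁) * (π * Real.sqrt 2)) / (B.Dtmin - κ₁)) + 2 * ((4 + κ₁) * (π * Real.sqrt 2) / (B.Dtmin - κ₁)) + π * Real.sqrt 2) with hAE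
  clear_value AE
  have hκ₁0 : 0 ≤ κ₁ := (norm_nonneg _).trans (hκ 0)
  have hAc : 0 ≤ AE * |c - π| := (abs_nonneg _).trans hvx
  have e1 : |VXE u x + VXE u (x + c)| ≤ AE * |c - π| := by rw [qvx, ← sub_eq_add_neg]; exact hvx
  have e2 : |VYE u x + VYE u (x + c)| ≤ AE * |c - π| := by rw [qvy, ← sub_eq_add_neg]; exact hvy
  have hD : |fderiv ℝ δ (momE u P x (x + c)) ![VXE u x + VXE u (x + c), VYE u x + VYE u (x + c)]| ≤ κ₁ * (AE * |c - π|) :=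
    abs_fderiv_vec2_le (hκ _) hAc e1 e2
  have hid : h3E δ u P (x + c) x + h3E δ u P x (x + c) =
      2 * Real.sin (SXE u P x (x + c)) * (VXE u x + VXE u (x + c)) + 2 * Real.sin (SYE u P x (x + c)) * (VYE u x + VYE u (x + c)) +
        fderiv ℝ δ (momE u P x (x + c)) ![VXE u x + VXE u (x + c), VYE u x + VYE u (x + c)] := by
    unfold h3E
    rw [SXE_swap u P (x + c) x, SYE_swap u P (x + c) x, momE_swap u P (x + c) x, ← clm_vec2_add]
    ring
  rw [hid]
  have hs1 : |2 * Real.sin (SXE u P x (x + c))| ≤ 2 := by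
    rw [abs_mul, abs_two]; linarith [Real.abs_sin_le_one (SXE u P x (x + c))]
  have hs2 : |2 * Real.sin (SYE u P x (x + c))| ≤ 2 := by
    rw [abs_mul, abs_two]; linarith [Real.abs_sin_le_one (SYE u P x (x + c))]
  have h12 := abs_two_term_le hs1 e1 hs2 e2
  have h := abs_add_le (2 * Real.sin (SXE u P x (x + c)) * (VXE u x + VXE u (x + c)) +
      2 * Real.sin (SYE u P x (x + c)) * (VYE u x + VYE u (x + c)))
    (fderiv ℝ δ (momE u P x (x + c)) ![VXE u x + VXE u (x + c), VYE u x + VYE u (x + c)])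
  nlinarith [abs_nonneg (c - π)]

/-- **Sup bound of the diagonal second derivative**: `≤ 16S_E² + 8A_E + 4κ₂S_E² + 2κ₁A_E`. [folklore] -/
theorem abs_diag_deriv2E_le (P : ℝ × ℝ) (x : ℝ) :
    |8 * (Real.cos (SXE u P x x) * VXE u x ^ 2 + Real.cos (SYE u P x x) * VYE u x ^ 2) +
        4 * (Real.sin (SXE u P x x) * (deriv (deriv u) x * Real.cos x - 2 * deriv u x * Real.sin x - u x * Real.cos x) +
          Real.sin (SYE u P x x) * (deriv (deriv u) x * Real.sin x + 2 * deriv u x * Real.cos x - u x * Real.sin x)) +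
        (4 * fderiv ℝ (fderiv ℝ δ) (momE u P x x) ![VXE u x, VYE u x] ![VXE u x, VYE u x] +
          2 * fderiv ℝ δ (momE u P x x) ![(deriv (deriv u) x * Real.cos x - 2 * deriv u x * Real.sin x - u x * Real.cos x),
            (deriv (deriv u) x * Real.sin x + 2 * deriv u x * Real.cos x - u x * Real.sin x)])| ≤
      16 * (B.smax + κ₁ * (π * Real.sqrt 2 + 2 * B.smax) / (B.Dtmin - κ₁)) ^ 2 + 8 * ((((4 + κ₂) * (B.smax + κ₁ * (π * Real.sqrt 2 + 2 * B.smax) / (B.Dtmin - κ₁)) ^ 2 + (8 + 2 * κ₁) * ((4 + κ₁) * (π * Real.sqrt 2) / (B.Dtmin - κ₁)) + (4 + κ₁) * (π * Real.sqrt 2)) / (B.Dtmin - κ₁)) + 2 * ((4 + κ₁) * (π * Real.sqrt 2) / (B.Dtmin - κ₁)) + π * Real.sqrt 2) + 4 * (κ₂ * (B.smax + κ₁ * (π * Real.sqrt 2 + 2 * B.smax) / (B.Dtmin - κ₁)) ^ 2) + 2 * (κ₁ * ((((4 + κ₂) * (B.smax + κ₁ * (π * Real.sqrt 2 + 2 *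 B.smax) / (B.Dtmin - κ₁)) ^ 2 + (8 + 2 * κ₁) * ((4 + κ₁) * (π * Real.sqrt 2) / (B.Dtmin - κ₁)) + (4 + κ₁) * (π * Real.sqrt 2)) / (B.Dtmin - κ₁)) + 2 * ((4 + κ₁) * (π * Real.sqrt 2) / (B.Dtmin - κ₁)) + π * Real.sqrt 2)) := by
  have h2ne : (2 : WithTop ℕ∞) ≠ 0 := by norm_num
  obtain ⟨bvx, bvy⟩ := abs_VXE_le B hδs h2ne (fun k _ => hδ k) hlo hhi (fun k _ => hκ k) hκ₁ hu x
  obtain ⟨hAXb, hAYb⟩ := abs_accel_le B hδs hδ hlo hhi hκ hκ₁ hκ₂ hu x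
  set SE := (B.smax + κ₁ * (π * Real.sqrt 2 + 2 * B.smax) / (B.Dtmin - κ₁)) with hSE
  set AE := ((((4 + κ₂) * (B.smax + κ₁ * (π * Real.sqrt 2 + 2 * B.smax) / (B.Dtmin - κ₁)) ^ 2 + (8 + 2 * κ₁) * ((4 + κ₁) * (π * Real.sqrt 2) / (B.Dtmin - κ₁)) + (4 + κ₁) * (π * Real.sqrt 2)) / (B.Dtmin - κ₁)) + 2 * ((4 + κ₁) * (π * Real.sqrt 2) / (B.Dtmin - κ₁)) + π * Real.sqrt 2) with hAE
  clear_value SE AE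
  set AX := (deriv (deriv u) x * Real.cos x - 2 * deriv u x * Real.sin x - u x * Real.cos x) with hAX
  set AY := (deriv (deriv u) x * Real.sin x + 2 * deriv u x * Real.cos x - u x * Real.sin x) with hAY
  have hSE0 : 0 ≤ SE := (abs_nonneg _).trans bvx
  have hAE0 : 0 ≤ AE := (abs_nonneg _).trans hAXb
  have hκ₂0 : 0 ≤ κ₂ := (norm_nonneg (fderiv ℝ (fderiv ℝ δ) 0)).trans (hκ₂ 0)
  have hsq1 : |VXE u x ^ 2| ≤ SE ^ 2 := by rw [abs_pow, sq, sq]; exact mul_le_mul bvx bvx (abs_nonneg _) hSE0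
  have hsq2 : |VYE u x ^ 2| ≤ SE ^ 2 := by rw [abs_pow, sq, sq]; exact mul_le_mul bvy bvy (abs_nonneg _) hSE0
  have e1 := abs_two_term_le (Real.abs_cos_le_one (SXE u P x x)) hsq1 (Real.abs_cos_le_one (SYE u P x x)) hsq2
  have e2 := abs_two_term_le (Real.abs_sin_le_one (SXE u P x x)) hAXb (Real.abs_sin_le_one (SYE u P x x)) hAYb
  have hv : ‖(![VXE u x, VYE u x] : Fin 2 → ℝ)‖ ≤ SE := norm_vec2_le hSE0 bvx bvy
  have hD2 : |fderiv ℝ (fderiv ℝ δ) (momE u P x x) ![VXE u x, VYE u x] ![VXE u x, VYE u x]| ≤ κ₂ * SE ^ 2 := by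
    refine (abs_fderiv_fderiv_le (hκ₂ _) ![VXE u x, VYE u x] ![VXE u x, VYE u x]).trans ?_
    rw [sq, mul_assoc]
    exact mul_le_mul_of_nonneg_left (mul_le_mul hv hv (norm_nonneg _) hSE0) hκ₂0
  have hD1 : |fderiv ℝ δ (momE u P x x) ![AX, AY]| ≤ κ₁ * AE := abs_fderiv_vec2_le (hκ _) hAE0 hAXb hAYb
  have h1 := abs_add_le (8 * (Real.cos (SXE u P x x) * VXE u x ^ 2 + Real.cos (SYE u P x x) * VYE u x ^ 2) +
        4 * (Real.sin (SXE u P x x) * AX + Real.sin (SYE u P x x) * AY))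
    (4 * fderiv ℝ (fderiv ℝ δ) (momE u P x x) ![VXE u x, VYE u x] ![VXE u x, VYE u x] +
          2 * fderiv ℝ δ (momE u P x x) ![AX, AY])
  have h2 := abs_add_le (8 * (Real.cos (SXE u P x x) * VXE u x ^ 2 + Real.cos (SYE u P x x) * VYE u x ^ 2))
        (4 * (Real.sin (SXE u P x x) * AX + Real.sin (SYE u P x x) * AY))
  have h3 := abs_add_le (4 * fderiv ℝ (fderiv ℝ δ) (momE u P x x) ![VXE u x, VYE u x] ![VXE u x, VYE u x])
          (2 * fderiv ℝ δ (momE u P x x) ![AX, AY])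
  rw [abs_mul, abs_mul, show |(8:ℝ)| = 8 by norm_num, show |(4:ℝ)| = 4 by norm_num] at h2
  rw [abs_mul, abs_mul, show |(4:ℝ)| = 4 by norm_num, abs_two] at h3
  linarith

end Fibres

end Summit.HubbardSuperconductivity.HubbardSuperconductivity.Theorems.PerturbedFermiCurve

end
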